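import Literature.AlgebraicGeometry.Resolution.RegularLocalRingsQuotient
import HarnessLib

/-!
# Crux `EquisingularLift` (stmt-ResolutionOfSingularities-15660), line `Sketch` (= `strata-split` v6):
# move-set stub `stub_goodGenerators_of_hypersurfaceLike`

[OURS · L1 W4.5b] Registered stub of the skeleton `Cruxes/EquisingularLift/Lines/Sketch.lean`
(sha `ec60f88acc0b`), proved BY NAME AND SIGNATURE. NOT a statement of any manuscript.

**Statement** (LHR alphabet, special-fibre half). In a regular local ring `(R, 𝔪)` let `J ⊆ 𝔪` be an
ideal generated by at most `c + 1` elements with `dim R/J + (c + 1) = dim R` and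
`μ(𝔪·R/J) ≤ dim R/J + 1` ("`R/J` is hypersurface-like"). Then `J = (g₀, …, g_c)` with
`R/(g₀, …, g_{c-1})` regular local of dimension `dim R - c`.

**Proof.** Induction on `c`, passing from `R` to `R/(x)` for an element `x ∈ J ∖ 𝔪²`:

* the hypotheses give `emb dim R/J ≤ dim R - c < dim R = emb dim R` (for `c + 1` in place of
  `c`), and `emb dim R/J + dim_k ((J + 𝔪²)/𝔪²) = emb dim R`
  (`spanFinrank_maximalIdeal_add_finrank_eq_of_surjective`), so some `x ∈ J` is not in `𝔪²`;
* `R₁ := R/(x)` is regular local with `dim R₁ + 1 = dim R` (Matsumura Thm. 14.2,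
  `IsRegularLocalRing.quotient_span_singleton`);
* writing `x = ∑ a_t t` over a minimal generating set `T` of `J`, some coefficient is a unit
  (else `x ∈ 𝔪²`), so `J = (x, T ∖ {t₀})` and `J₁ := J R₁` needs at most `c + 1` generators;
* `R₁/J₁ ≅ R/J` (third isomorphism theorem), so the dimension and embedding-dimension
  hypotheses pass to `(R₁, J₁)`, and the induction hypothesis gives `J₁ = (f̄, ȳ)` with `R₁/(f̄)`
  regular of dimension `dim R₁ - c`; lifting, `J = (x, f, y)` and `R/(x, f) ≅ R₁/(f̄)`.

The base case `c = 0` says only that an ideal with at most one generator is principal.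
-/

set_option linter.dupNamespace false -- mandated namespace `Summit.<Summit>.<Problem>` of this single-conjunct summit

namespace Summit.ResolutionOfSingularities.ResolutionOfSingularities.Cruxes.EquisingularLift.StrataSplit

open IsLocalRing Literature.AlgebraicGeometry.Resolution

section Helpers

variable {R : Type*} [CommRing R]

/-- In a Noetherian local ring, if the embedding dimension of `R/J` is smaller than that of `R`
(`J ⊆ 𝔪`), then `J` contains an element outside `𝔪²` (the cotangent space of `R/J` is
`𝔪/(J + 𝔪²)`). [OURS · L1 W4.5b] helper for `stub_goodGenerators_of_hypersurfaceLike`. -/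
theorem goodGen_exists_mem_not_mem_sq [IsLocalRing R] [IsNoetherianRing R] {J : Ideal R}
    (hJ : J ≤ maximalIdeal R)
    (hlt : ((maximalIdeal R).map (Ideal.Quotient.mk J)).spanFinrank <
      (maximalIdeal R).spanFinrank) :
    ∃ x ∈ J, x ∉ maximalIdeal R ^ 2 := by
  have hJtop : J ≠ ⊤ := fun h => (maximalIdeal.isMaximal R).ne_top (top_le_iff.mp (h ▸ hJ))
  haveI : Nontrivial (R ⧸ J) := Ideal.Quotient.nontrivial_iff.mpr hJtop
  haveI : IsLocalRing (R ⧸ J) :=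
    IsLocalRing.of_surjective' (Ideal.Quotient.mk J) Ideal.Quotient.mk_surjective
  haveI : IsLocalHom (algebraMap R (R ⧸ J)) :=
    IsLocalHom.of_surjective _ (Ideal.Quotient.mk_surjective (I := J))
  have key := spanFinrank_maximalIdeal_add_finrank_eq_of_surjective (R := R) (S := R ⧸ J)
    (Ideal.Quotient.mk_surjective (I := J))
  have hker : RingHom.ker (algebraMap R (R ⧸ J)) = J := by
    rw [Ideal.Quotient.algebraMap_eq, Ideal.mk_ker]
  rw [maximalIdeal_quotient_eq_map J, hker] at key
  by_contra! H
  have hzero : Submodule.span (ResidueField R) ((maximalIdeal R).toCotangent ''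
      (Submodule.comap (maximalIdeal R).subtype J : Set (maximalIdeal R))) = ⊥ := by
    rw [Submodule.span_eq_bot]
    rintro _ ⟨m, hm, rfl⟩
    exact ((maximalIdeal R).toCotangent_eq_zero m).mpr (H m (Submodule.mem_comap.mp hm))
  rw [hzero, finrank_bot, add_zero] at key
  omega

/-- Exchange lemma: in a local ring, if `T ⊆ 𝔪` is finite and `x ∈ (T)` is not in `𝔪²`, then in
`x = ∑ a_t t` some coefficient `a_{t₀}` is a unit, so `(T) = (x, T ∖ {t₀})`.
[OURS · L1 W4.5b] helper for `stub_goodGenerators_of_hypersurfaceLike`. -/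
theorem goodGen_exists_span_eq_span_insert_erase [IsLocalRing R] [DecidableEq R] (T : Finset R)
    (hT : (T : Set R) ⊆ maximalIdeal R) {x : R} (hx : x ∈ Ideal.span (T : Set R))
    (hx2 : x ∉ maximalIdeal R ^ 2) :
    ∃ y ∈ T, Ideal.span (T : Set R) = Ideal.span (insert x ((T.erase y : Finset R) : Set R)) := by
  obtain ⟨a, -, hsum⟩ := Submodule.mem_span_finset.mp hx
  -- some coefficient is a unit, since `x ∉ 𝔪²`
  obtain ⟨y, hyT, hu⟩ : ∃ y ∈ T, IsUnit (a y) := by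
    by_contra! H
    apply hx2
    rw [← hsum, pow_two]
    exact Ideal.sum_mem _ fun y hy =>
      Ideal.mul_mem_mul ((mem_maximalIdeal _).mpr (mem_nonunits_iff.mpr (H y hy))) (hT hy)
  have hy : y ∈ Ideal.span (insert x ((T.erase y : Finset R) : Set R)) := by
    have h1 : a y • y = x - ∑ w ∈ T.erase y, a w • w := by
      rw [← hsum, ← Finset.add_sum_erase T (fun w => a w • w) hyT, add_sub_cancel_right]
    have h2 : a y • y ∈ Ideal.span (insert x ((T.erase y : Finset R) : Set R)) := by
      rw [h1]
      refine Ideal.sub_mem _ (Ideal.subset_span (Set.mem_insert _ _))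
        (Ideal.sum_mem _ fun w hw => ?_)
      exact Ideal.mul_mem_left _ _
        (Ideal.subset_span (Set.mem_insert_of_mem _ (Finset.mem_coe.mpr hw)))
    have h3 := Ideal.mul_mem_left _ (↑hu.unit⁻¹ : R) h2
    rwa [smul_eq_mul, ← mul_assoc, IsUnit.val_inv_mul, one_mul] at h3
  refine ⟨y, hyT, le_antisymm ?_ ?_⟩
  · rw [Ideal.span_le]
    intro z hz
    by_cases hzy : z = y
    · rw [hzy]
      exact hy
    · exact Ideal.subset_span
        (Set.mem_insert_of_mem _ (Finset.mem_coe.mpr (Finset.mem_erase.mpr ⟨hzy, hz⟩)))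
  · rw [Ideal.span_le]
    rintro z (rfl | hz)
    · exact hx
    · exact Ideal.subset_span (Finset.mem_coe.mpr (Finset.mem_of_mem_erase (Finset.mem_coe.mp hz)))

/-- The range of `Fin.snoc f a` is `{a} ∪ range f`. [OURS · L1 W4.5b] helper. -/
theorem goodGen_range_snoc {α : Type*} {n : ℕ} (f : Fin n → α) (a : α) :
    Set.range (Fin.snoc f a : Fin (n + 1) → α) = insert a (Set.range f) := by
  ext z
  simp only [Set.mem_range, Set.mem_insert_iff]
  constructor
  · rintro ⟨i, rfl⟩
    rcases Fin.eq_castSucc_or_eq_last i with ⟨j, rfl⟩ | rfl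
    · exact Or.inr ⟨j, (Fin.snoc_castSucc (α := fun _ => α) _ _ _).symm⟩
    · exact Or.inl (Fin.snoc_last (α := fun _ => α) _ _)
  · rintro (rfl | ⟨j, rfl⟩)
    · exact ⟨Fin.last n, Fin.snoc_last (α := fun _ => α) _ _⟩
    · exact ⟨j.castSucc, Fin.snoc_castSucc (α := fun _ => α) _ _ _⟩

/-- Third isomorphism theorem, dimensions: `dim (R/I)/(J/I) = dim R/J` for `I ≤ J`.
[OURS · L1 W4.5b] helper. -/
theorem goodGen_ringKrullDim_quotQuot {I J : Ideal R} (h : I ≤ J) :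
    ringKrullDim ((R ⧸ I) ⧸ J.map (Ideal.Quotient.mk I)) = ringKrullDim (R ⧸ J) :=
  ringKrullDim_eq_of_ringEquiv (DoubleQuot.quotQuotEquivQuotOfLE h)

/-- Third isomorphism theorem, images of an ideal `M`: the image of `M (R/I)` in `(R/I)/(J/I)`
needs as many generators as the image of `M` in `R/J` (`I ≤ J`). [OURS · L1 W4.5b] helper. -/
theorem goodGen_spanFinrank_map_quotQuot {I J : Ideal R} (h : I ≤ J) (M : Ideal R) :
    ((M.map (Ideal.Quotient.mk I)).map
        (Ideal.Quotient.mk (J.map (Ideal.Quotient.mk I)))).spanFinrank =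
      (M.map (Ideal.Quotient.mk J)).spanFinrank := by
  rw [Ideal.map_map]
  change (M.map (DoubleQuot.quotQuotMk I J)).spanFinrank = _
  rw [← DoubleQuot.quotQuotEquivQuotOfLE_symm_comp_mk h, ← Ideal.map_map, Ideal.map_coe]
  exact Ideal.spanFinrank_map_eq_of_ringEquiv _ _

end Helpers

/-- The induction behind `stub_goodGenerators_of_hypersurfaceLike`, with the conclusion in the
form `J = (y, f)`, `R/(f)` regular of dimension `dim R - c` for a family `f : Fin c → R`.
[OURS · L1 W4.5b] helper. -/
theorem goodGen_aux (c : ℕ) : ∀ (R : Type) [CommRing R] [IsRegularLocalRing R] (J : Ideal R),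
    J ≤ IsLocalRing.maximalIdeal R → J.spanFinrank ≤ c + 1 →
    ringKrullDim (R ⧸ J) + (c + 1) = ringKrullDim R →
    ((Ideal.map (Ideal.Quotient.mk J) (IsLocalRing.maximalIdeal R)).spanFinrank : WithBot ℕ∞) ≤
      ringKrullDim (R ⧸ J) + 1 →
    ∃ (f : Fin c → R) (y : R), J = Ideal.span (insert y (Set.range f)) ∧
      IsRegularLocalRing (R ⧸ Ideal.span (Set.range f)) ∧
      ringKrullDim (R ⧸ Ideal.span (Set.range f)) + c = ringKrullDim R := by
  induction c with
  | zero =>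
    intro R _ _ J _ hfin _ _
    classical
    -- `J` is principal
    obtain ⟨T, hTcard, hTspan⟩ :=
      Submodule.FG.exists_span_finset_card_eq_spanFinrank (IsNoetherian.noetherian J)
    have hcard : T.card ≤ 1 := by omega
    obtain ⟨y, hy⟩ : ∃ y : R, J = Ideal.span {y} := by
      rcases Nat.le_one_iff_eq_zero_or_eq_one.mp hcard with h0 | h1
      · rw [Finset.card_eq_zero] at h0
        rw [h0, Finset.coe_empty, Submodule.span_empty] at hTspan
        exact ⟨0, by rw [← hTspan, Ideal.span_singleton_eq_bot.mpr rfl]⟩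
      · obtain ⟨y, hTy⟩ := Finset.card_eq_one.mp h1
        rw [hTy, Finset.coe_singleton] at hTspan
        exact ⟨y, hTspan.symm⟩
    have hr : Set.range (fun _ : Fin 0 => (0 : R)) = ∅ := Set.range_eq_empty _
    refine ⟨fun _ => 0, y, ?_, ?_, ?_⟩
    · rw [hr, insert_empty_eq]
      exact hy
    · rw [hr, Ideal.span_empty]
      exact IsRegularLocalRing.of_ringEquiv (RingEquiv.quotientBot R).symm
    · rw [hr, Ideal.span_empty, Nat.cast_zero, add_zero]
      exact ringKrullDim_eq_of_ringEquiv (RingEquiv.quotientBot R)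
  | succ c ih =>
    intro R _ _ J hJ hfin hdim hedim
    classical
    -- the local ring `R/J`
    have hJtop : J ≠ ⊤ := fun h => (maximalIdeal.isMaximal R).ne_top (top_le_iff.mp (h ▸ hJ))
    haveI : Nontrivial (R ⧸ J) := Ideal.Quotient.nontrivial_iff.mpr hJtop
    haveI : IsLocalRing (R ⧸ J) :=
      IsLocalRing.of_surjective' (Ideal.Quotient.mk J) Ideal.Quotient.mk_surjective
    -- numerics: `n = dim R/J`, `d = dim R = emb dim R`
    obtain ⟨n, hn⟩ := exists_nat_cast_eq_ringKrullDim (R := R ⧸ J)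
    have hdR : ((maximalIdeal R).spanFinrank : WithBot ℕ∞) = ringKrullDim R :=
      IsRegularLocalRing.spanFinrank_maximalIdeal
    have hdim' : n + (c + 1 + 1) = (maximalIdeal R).spanFinrank := by
      rw [hn, ← hdR] at hdim
      exact_mod_cast hdim
    have hedim' : (Ideal.map (Ideal.Quotient.mk J) (maximalIdeal R)).spanFinrank ≤ n + 1 := by
      rw [hn] at hedim
      exact_mod_cast hedim
    -- an element `x ∈ J ∖ 𝔪²`, and the regular local ring `R₁ = R/(x)`
    obtain ⟨x, hxJ, hx2⟩ := goodGen_exists_mem_not_mem_sq hJ (by omega)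
    have hxm : x ∈ maximalIdeal R := hJ hxJ
    have hxJ' : Ideal.span {x} ≤ J := (Ideal.span_singleton_le_iff_mem _).mpr hxJ
    obtain ⟨hreg₁, hdim₁⟩ := IsRegularLocalRing.quotient_span_singleton hxm hx2
    haveI := hreg₁
    obtain ⟨d₁, hd₁⟩ := exists_nat_cast_eq_ringKrullDim (R := R ⧸ Ideal.span {x})
    have hd₁' : d₁ + 1 = (maximalIdeal R).spanFinrank := by
      have h := hdim₁
      rw [hd₁, ← hdR] at h
      exact_mod_cast h
    -- a minimal generating set `T` of `J`; exchange one generator against `x`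
    obtain ⟨T, hTcard, hTspan⟩ :=
      Submodule.FG.exists_span_finset_card_eq_spanFinrank (IsNoetherian.noetherian J)
    have hTspan' : Ideal.span (T : Set R) = J := hTspan
    have hTm : (T : Set R) ⊆ maximalIdeal R := fun z hz =>
      hJ (by rw [← hTspan']; exact Ideal.subset_span hz)
    have hxT : x ∈ Ideal.span (T : Set R) := by rw [hTspan']; exact hxJ
    obtain ⟨y₀, hy₀T, hexch⟩ := goodGen_exists_span_eq_span_insert_erase T hTm hxT hx2
    -- `J₁ = J R₁` is generated by the images of `T ∖ {y₀}`
    have hJ₁ : J.map (Ideal.Quotient.mk (Ideal.span {x})) =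
        Ideal.span ((Ideal.Quotient.mk (Ideal.span {x})) '' ((T.erase y₀ : Finset R) : Set R)) := by
      rw [← hTspan', hexch, Ideal.map_span, Set.image_insert_eq,
        Ideal.Quotient.eq_zero_iff_mem.mpr (Ideal.mem_span_singleton_self x), Ideal.span_insert_zero]
    have hfin₁ : (J.map (Ideal.Quotient.mk (Ideal.span {x}))).spanFinrank ≤ c + 1 := by
      rw [hJ₁]
      refine (Submodule.spanFinrank_span_le_ncard_of_finite (Set.toFinite _)).trans ?_
      refine (Set.ncard_image_le (Finset.finite_toSet _)).trans ?_
      rw [Set.ncard_coe_finset, Finset.card_erase_of_mem hy₀T, hTcard]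
      omega
    have hJ₁m : J.map (Ideal.Quotient.mk (Ideal.span {x})) ≤ maximalIdeal (R ⧸ Ideal.span {x}) := by
      rw [maximalIdeal_quotient_eq_map (Ideal.span {x})]
      exact Ideal.map_mono hJ
    -- `R₁/J₁ ≅ R/J`: the dimension and embedding-dimension hypotheses pass to `(R₁, J₁)`
    have hdimJ₁ : ringKrullDim ((R ⧸ Ideal.span {x}) ⧸ J.map (Ideal.Quotient.mk (Ideal.span {x}))) +
        (c + 1) = ringKrullDim (R ⧸ Ideal.span {x}) := by
      rw [goodGen_ringKrullDim_quotQuot hxJ', hn, hd₁]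
      have : n + (c + 1) = d₁ := by omega
      exact_mod_cast this
    have hedim₁ : (((maximalIdeal (R ⧸ Ideal.span {x})).map (Ideal.Quotient.mk
        (J.map (Ideal.Quotient.mk (Ideal.span {x}))))).spanFinrank : WithBot ℕ∞) ≤
        ringKrullDim ((R ⧸ Ideal.span {x}) ⧸ J.map (Ideal.Quotient.mk (Ideal.span {x}))) + 1 := by
      rw [maximalIdeal_quotient_eq_map (Ideal.span {x}), goodGen_spanFinrank_map_quotQuot hxJ',
        goodGen_ringKrullDim_quotQuot hxJ', hn]
      exact_mod_cast hedim'
    obtain ⟨f₁, y₁, hJ₁eq, _hreg, hdim_f₁⟩ := ih (R ⧸ Ideal.span {x})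
      (J.map (Ideal.Quotient.mk (Ideal.span {x}))) hJ₁m hfin₁ hdimJ₁ hedim₁
    -- lift `f₁`, `y₁` to `R` and put `x` in front
    obtain ⟨f', hf'⟩ : ∃ f' : Fin c → R, Ideal.Quotient.mk (Ideal.span {x}) ∘ f' = f₁ :=
      ⟨fun i => (Ideal.Quotient.mk_surjective (f₁ i)).choose,
        funext fun i => (Ideal.Quotient.mk_surjective (f₁ i)).choose_spec⟩
    obtain ⟨y', hy'⟩ := Ideal.Quotient.mk_surjective (I := Ideal.span {x}) y₁
    have hcons : Ideal.span (Set.range (Fin.cons x f' : Fin (c + 1) → R)) =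
        Ideal.span {x} ⊔ Ideal.span (Set.range f') := by
      rw [Fin.range_cons, Ideal.span_insert]
    have hmapf' : (Ideal.span (Set.range f')).map (Ideal.Quotient.mk (Ideal.span {x})) =
        Ideal.span (Set.range f₁) := by
      rw [Ideal.map_span, ← Set.range_comp, hf']
    let e : ((R ⧸ Ideal.span {x}) ⧸ Ideal.span (Set.range f₁)) ≃+*
        R ⧸ Ideal.span (Set.range (Fin.cons x f' : Fin (c + 1) → R)) :=
      (Ideal.quotEquivOfEq hmapf'.symm).trans
        ((DoubleQuot.quotQuotEquivQuotSup (Ideal.span {x}) (Ideal.span (Set.range f'))).trans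
          (Ideal.quotEquivOfEq hcons.symm))
    refine ⟨Fin.cons x f', y', ?_, IsRegularLocalRing.of_ringEquiv e, ?_⟩
    · -- `J = (x, f', y')` by pulling `J₁ = (f̄, ȳ)` back along `R → R₁`
      have h1 : J.map (Ideal.Quotient.mk (Ideal.span {x})) =
          (Ideal.span (insert y' (Set.range f'))).map (Ideal.Quotient.mk (Ideal.span {x})) := by
        rw [hJ₁eq, Ideal.map_span, Set.image_insert_eq, ← Set.range_comp, hf', hy']
      have h2 := congrArg (Ideal.comap (Ideal.Quotient.mk (Ideal.span {x}))) h1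
      simp only [Ideal.comap_map_of_surjective' _ Ideal.Quotient.mk_surjective, Ideal.mk_ker] at h2
      rw [sup_eq_left.mpr hxJ', ← Ideal.span_union, Set.union_singleton] at h2
      rw [h2, Fin.range_cons, Set.insert_comm]
    · rw [← ringKrullDim_eq_of_ringEquiv e, Nat.cast_succ, ← add_assoc, hdim_f₁, hdim₁]

/-- **Stub `stub_goodGenerators_of_hypersurfaceLike`** of line `Sketch` for the crux `EquisingularLift`
(stmt-ResolutionOfSingularities-15660), by name and signature: in a regular local ring `R`, an ideal
`J ⊆ 𝔪` with at most `c + 1` generators, `dim R/J + (c + 1) = dim R` and `μ(𝔪·R/J) ≤ dim R/J + 1`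
is generated by `c + 1` elements the first `c` of which cut out a regular local ring of dimension
`dim R - c`. [OURS · L1 W4.5b] move-set lemma; NOT a statement of the manuscript. -/
theorem stub_goodGenerators_of_hypersurfaceLike : ∀ (R : Type) [CommRing R] [IsRegularLocalRing R] (J : Ideal R) (c : ℕ), J ≤ IsLocalRing.maximalIdeal R → J.spanFinrank ≤ c + 1 → ringKrullDim (R ⧸ J) + (c + 1) = ringKrullDim R → ((Ideal.map (Ideal.Quotient.mk J) (IsLocalRing.maximalIdeal R)).spanFinrank : WithBot ℕ∞) ≤ ringKrullDim (R ⧸ J) + 1 → ∃ g : Fin (c + 1) → R, J = Ideal.span (Set.range g) ∧ IsRegularLocalRing (R ⧸ Ideal.span (Set.range (fun i : Fin c => g i.castSucc))) ∧ ringKrullDim (R ⧸ Ideal.span (Set.range (fun i : Fin c => g i.castSucc))) + c = ringKrullDim R := by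
  intro R _ _ J c hJ hfin hdim hedim
  obtain ⟨f, y, hJ', hreg, hd⟩ := goodGen_aux c R J hJ hfin hdim hedim
  refine ⟨Fin.snoc f y, ?_, ?_, ?_⟩
  · rw [goodGen_range_snoc]
    exact hJ'
  · have h := hreg
    rw [← Fin.init_snoc (α := fun _ => R) y f] at h
    exact h
  · have h := hd
    rw [← Fin.init_snoc (α := fun _ => R) y f] at h
    exact h

end Summit.ResolutionOfSingularities.ResolutionOfSingularities.Cruxes.EquisingularLift.StrataSplit
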